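import Mathlib
import HarnessLib
import Summits.HubbardSuperconductivity.HubbardSuperconductivity.Theorems.KLProgrammeKLRegimeEnginePairTransferBudgetScalarRows

/-!
# Route `KLProgramme` — ENGINE item stmt-HubbardSuperconductivity-20437 `KLRegimeEngineV17F2`, class #5 rev 3, (X).3 BUDGET ARITHMETIC — «88b» THE PINNED PAIR:
# the scalar rows (B2″)/(B3″) AT THE PINNED PAIR from SIZE hypotheses — `klpp_scalarRow_direct/crossed_pinned_of_sizes`
# (cell gate-hubbard-kl, seat hubbard-kl-k3c1-p1 g17; pinned twins of row 89 `klbd_scalarRow_direct/crossed_of_sizes`; CLASS5-RESOLVED-STEP.md §17)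

WHY.  On the pinned-pair spine the `min`-slot coefficients at `j′ = n+1`, `1 ≤ n` read `c_d″ = M4²·K′·(32·8²·G²) + (KlamU)²·tD + (η4M4+M4η4)·K·16384G²`
(`K′ = K·Λ_{j′}/Λₙ = K/4`; the EDGE two-shell slot of `WDd_edge_row_le_slots`, c = 8, and the forward row's `min` coefficient `tD`), crossed `32·16²`, `tX`
(below the top edge).  Exactly as row 89 (same size currencies `M4 ≤ c₄U`, `η4 ≤ e₄·U·(Λₙ₊₁·klIdxMass (n+1) j′)`, regime numbers `Gfr₁U² ≤ 1`, `8Gβ ≤ L`), with ONE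
threshold row each: (T2p) `A2s·(32855·c₄² + 2²⁸·4⁻ⁿ·e₄c₄) + (4/15367)·tD·Klam² ≤ (9/20)·θ·r·Klam²`, (T3p) `A2s·(65709·c₄² + 2²⁷·4⁻ⁿ·e₄c₄) + (4/15367)·tX·Klam² ≤ (9/20)·θ·r·Klam²`
(`32855 = ⌈1155.03·2048/72⌉`, `65709 = ⌈2711.1·8192/338⌉`; `klIdxMass n (n+1) = 15367/4`).  Pricing (memo §17): at the A25 cap the `c₄²` entries close iff `(c₄/Klam)² ≲ 1.6` (θ = 1/5),
the `tD/tX` entries are the (γ)-TR question.  Pure real arithmetic; nothing about the model's sizes is asserted; nothing asserts (X).3, (c), K3 or superconductivity.  0 kit · 0 lit.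
-/

noncomputable section

namespace Summit.HubbardSuperconductivity.HubbardSuperconductivity.Theorems.KLRegimeSplit

set_option linter.dupNamespace false -- summit = problem name (single-conjunct summit), D-0017

open Finset Literature.MathematicalPhysics.QuantumLattice Literature.Probability.LatticeModels
open Summit.HubbardSuperconductivity.HubbardSuperconductivity.Theorems.KLProgrammeLegKernels
open Summit.HubbardSuperconductivity.HubbardSuperconductivity.Theorems.DispersionFlow
open Summit.HubbardSuperconductivity.HubbardSuperconductivity.Theorems.EngineV8

section ScalarRowsPinned

set_option maxHeartbeats 800000 in
/-- **(B2″) at the pinned pair from sizes** (module docstring). -/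
theorem klpp_scalarRow_direct_pinned_of_sizes (P : SplitConsts) (R : RenConsts) (hGfr : 0 ≤ R.Gfr 1) {A2s M4 η4 U β θ r c₄ e₄ tD : ℝ} {L : ℕ} [NeZero L] {n j' : ℕ}
    (hn : 1 ≤ n) (hj : j' = n + 1) (hA2s : 0 ≤ A2s) (hU : 0 ≤ U) (hβ : 0 ≤ β) (hθ : 0 ≤ θ) (hr : 0 ≤ r) (hc₄ : 0 ≤ c₄) (he₄ : 0 ≤ e₄)
    (hM4 : 0 ≤ M4) (hM4c : M4 ≤ c₄ * U) (htD : 0 ≤ tD) (hη4 : 0 ≤ η4) (hη4e : η4 ≤ e₄ * U * (klScale klE0 (n + 1) * klIdxMass (n + 1) j'))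
    (hGU : R.Gfr 1 * U ^ 2 ≤ 1) (hGL : 8 * (4 + 8 / 3 * R.Gfr 1 * U ^ 2) * β ≤ L)
    (hth : A2s * (32855 * c₄ ^ 2 + 2 ^ 28 * ((4 : ℝ) ^ n)⁻¹ * (e₄ * c₄)) + 4 / 15367 * (tD * P.Klam ^ 2) ≤ 9 / 20 * (θ * (r * P.Klam ^ 2))) :
    (M4 * M4 * (if 1 ≤ n ∧ n + 2 ≤ j' then 512 / 3 * (27 / (8 * Real.pi ^ 2)) * A2s * (16 * (klScale klE0 j' / klScale klE0 n)) / Real.pi * (10 + 50 * (4 + 8 / 3 * R.Gfr 1 * U ^ 2) * β / L) * (72 * (4 + 8 / 3 * R.Gfr 1 * U ^ 2) ^ 2) else if 1 ≤ n ∧ j' = n + 1 then 512 / 3 * (27 / (8 * Real.pi ^ 2)) * A2s * (16 * (klScale klE0 j' / klScale klE0 n)) / Real.pi * (10 + 50 * (4 + 8 / 3 * R.Gfr 1 * U ^ 2) * β / L) * (32 * 8 ^ 2 * (4 + 8 / 3 * R.Gfr 1 * U ^ 2) ^ 2) else 0) + (if 1 ≤ n ∧ j' = n + 1 then (P.Klam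 * U) ^ 2 * tD else 0) + (η4 * M4 + M4 * η4) * (if n = 0 then (0 : ℝ) else 512 / 3 * (27 / (8 * Real.pi ^ 2)) * A2s * (16 / Real.pi) * (10 + 50 * (4 + 8 / 3 * R.Gfr 1 * U ^ 2) * β / L) * (16384 * (4 + 8 / 3 * R.Gfr 1 * U ^ 2) ^ 2))) ≤
      2⁻¹ * (θ * (3 / 5 * (klIdxPrefactor r (n + 1) * ((P.Klam * U) ^ 2 * klIdxMass n j')))) := by
  obtain ⟨hG4, hG, hB⟩ := klbd_regime_numbers hGfr hGU hGL
  set G : ℝ := 4 + 8 / 3 * R.Gfr 1 * U ^ 2 with hGdef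
  set B : ℝ := 10 + 50 * G * β / L with hBdef
  set ms : ℝ := klIdxMass n j' with hms
  have hms0 : 0 ≤ ms := klIdxMass_nonneg n j'
  have hκ := klbd_angular_numeral_le_two
  have hπ0 : (0 : ℝ) < Real.pi := Real.pi_pos
  have hκ0 : 0 ≤ 27 / (8 * Real.pi ^ 2) * (16 / Real.pi) := by positivity
  have hG0 : 0 ≤ G := by linarith
  have hB0 : 0 ≤ B := by
    have hL0 : (0 : ℝ) ≤ L := Nat.cast_nonneg L
    have : 0 ≤ 50 * G * β / L := by positivity
    rw [hBdef]; linarith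
  have hG2 : G ^ 2 ≤ (20 / 3) ^ 2 := pow_le_pow_left₀ hG0 hG 2
  have hratio : klScale klE0 j' / klScale klE0 n = ms / 15367 := klbd_klScale_div_eq_klIdxMass (by omega)
  have hκD : klScale klE0 (n + 1) * klIdxMass (n + 1) j' = ms * ((4 : ℝ) ^ n)⁻¹ / 32 := klbd_kappaD_sq_eq (le_of_eq hj.symm)
  have h4n : 0 ≤ ((4 : ℝ) ^ n)⁻¹ := by positivity
  rw [hκD] at hη4e
  -- the `M4²` term (D-line `min`-slot coefficient; present only in the interior)
  have hT1 : M4 * M4 * (if 1 ≤ n ∧ n + 2 ≤ j' then 512 / 3 * (27 / (8 * Real.pi ^ 2)) * A2s * (16 * (klScale klE0 j' / klScale klE0 n)) / Real.pi * B * (72 * G ^ 2) else if 1 ≤ n ∧ j' = n + 1 then 512 / 3 * (27 / (8 * Real.pi ^ 2)) * A2s * (16 * (klScale klE0 j' / klScale klE0 n)) / Real.pi * B * (32 * 8 ^ 2 * G ^ 2) else 0) ≤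
      (c₄ * U) * (c₄ * U) * (512 / 3 * 2 * A2s * (ms / 15367) * (65 / 4) * (2048 * (20 / 3) ^ 2)) := by
    rw [if_neg (by omega), if_pos ⟨hn, hj⟩, hratio]
    have hre : 512 / 3 * (27 / (8 * Real.pi ^ 2)) * A2s * (16 * (ms / 15367)) / Real.pi * B * (32 * 8 ^ 2 * G ^ 2) =
        512 / 3 * (27 / (8 * Real.pi ^ 2) * (16 / Real.pi)) * A2s * (ms / 15367) * B * (2048 * G ^ 2) := by
      field_simp
      ring
    rw [hre]
    have hMM : M4 * M4 ≤ (c₄ * U) * (c₄ * U) := mul_le_mul hM4c hM4c hM4 (by positivity)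
    gcongr
  have hT2 : (η4 * M4 + M4 * η4) * (if n = 0 then (0 : ℝ) else 512 / 3 * (27 / (8 * Real.pi ^ 2)) * A2s * (16 / Real.pi) * B * (16384 * G ^ 2)) ≤
      (2 * ((e₄ * U * (ms * ((4 : ℝ) ^ n)⁻¹ / 32)) * (c₄ * U))) * (512 / 3 * 2 * A2s * (65 / 4) * (16384 * (20 / 3) ^ 2)) := by
    rw [if_neg (by omega)]
    have hre : 512 / 3 * (27 / (8 * Real.pi ^ 2)) * A2s * (16 / Real.pi) * B * (16384 * G ^ 2) =
        512 / 3 * (27 / (8 * Real.pi ^ 2) * (16 / Real.pi)) * A2s * B * (16384 * G ^ 2) := by ring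
    rw [hre]
    have hηM : η4 * M4 + M4 * η4 ≤ 2 * ((e₄ * U * (ms * ((4 : ℝ) ^ n)⁻¹ / 32)) * (c₄ * U)) := by
      have := mul_le_mul hη4e hM4c hM4 (by positivity)
      linarith [mul_comm η4 M4]
    have h0 : 0 ≤ η4 * M4 + M4 * η4 := by positivity
    gcongr
  -- the slot from below: `Pref ≥ 3r/2`
  have hP : 3 / 2 * r ≤ klIdxPrefactor r (n + 1) := klbd_three_halves_le_klIdxPrefactor_succ hr n
  have hslot : 9 / 20 * (θ * (r * P.Klam ^ 2)) * (U ^ 2 * ms) ≤ 2⁻¹ * (θ * (3 / 5 * (klIdxPrefactor r (n + 1) * ((P.Klam * U) ^ 2 * ms)))) := by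
    have h1 : 0 ≤ θ * (P.Klam ^ 2 * (U ^ 2 * ms)) := by positivity
    have h2 := mul_le_mul_of_nonneg_left hP h1
    linarith
  -- assembly (each bound is a numeral times ONE monomial)
  have hT3 : (if 1 ≤ n ∧ j' = n + 1 then (P.Klam * U) ^ 2 * tD else 0) ≤ (P.Klam * U) ^ 2 * tD := by
    split_ifs
    · exact le_rfl
    · positivity
  have hms4 : ms = 15367 / 4 := by
    rw [hms, hj]; unfold klIdxMass; rw [Nat.add_sub_cancel_left]; norm_num
  have hc : (P.Klam * U) ^ 2 * tD = 4 / 15367 * (tD * P.Klam ^ 2) * (U ^ 2 * ms) := by rw [hms4]; ring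
  have hXa : 0 ≤ A2s * c₄ ^ 2 * (U ^ 2 * ms) := by positivity
  have hXb : 0 ≤ A2s * (((4 : ℝ) ^ n)⁻¹ * (e₄ * c₄)) * (U ^ 2 * ms) := by positivity
  have ha : (c₄ * U) * (c₄ * U) * (512 / 3 * 2 * A2s * (ms / 15367) * (65 / 4) * (2048 * (20 / 3) ^ 2)) ≤ A2s * (32855 * c₄ ^ 2) * (U ^ 2 * ms) := by
    linarith
  have hb : (2 * ((e₄ * U * (ms * ((4 : ℝ) ^ n)⁻¹ / 32)) * (c₄ * U))) * (512 / 3 * 2 * A2s * (65 / 4) * (16384 * (20 / 3) ^ 2)) ≤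
      A2s * (2 ^ 28 * ((4 : ℝ) ^ n)⁻¹ * (e₄ * c₄)) * (U ^ 2 * ms) := by
    linarith
  have hfin := mul_le_mul_of_nonneg_right hth (show 0 ≤ U ^ 2 * ms by positivity)
  linarith [hT1, hT2, hT3, hc, ha, hb, hfin, hslot]


set_option maxHeartbeats 800000 in
/-- **(B3″) at the pinned pair from sizes** (module docstring). -/
theorem klpp_scalarRow_crossed_pinned_of_sizes (P : SplitConsts) (R : RenConsts) (hGfr : 0 ≤ R.Gfr 1) {A2s M4 η4 U β θ r c₄ e₄ tX : ℝ} {L : ℕ} [NeZero L] {n j' : ℕ}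
    (hn : 1 ≤ n) (hj : j' = n + 1) (hA2s : 0 ≤ A2s) (hU : 0 ≤ U) (hβ : 0 ≤ β) (hθ : 0 ≤ θ) (hr : 0 ≤ r) (hc₄ : 0 ≤ c₄) (he₄ : 0 ≤ e₄)
    (hM4 : 0 ≤ M4) (hM4c : M4 ≤ c₄ * U) (htX : 0 ≤ tX) (hη4 : 0 ≤ η4) (hη4e : η4 ≤ e₄ * U * (klScale klE0 (n + 1) * klIdxMass (n + 1) j'))
    (hGU : R.Gfr 1 * U ^ 2 ≤ 1) (hGL : 8 * (4 + 8 / 3 * R.Gfr 1 * U ^ 2) * β ≤ L)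
    (hth : A2s * (65709 * c₄ ^ 2 + 2 ^ 27 * ((4 : ℝ) ^ n)⁻¹ * (e₄ * c₄)) + 4 / 15367 * (tX * P.Klam ^ 2) ≤ 9 / 20 * (θ * (r * P.Klam ^ 2))) :
    (M4 * M4 * (if 1 ≤ n ∧ n + 2 ≤ j' ∧ n + 3 ≤ nScales β then 256 / 3 * (27 / (8 * Real.pi ^ 2)) * A2s * (16 * (klScale klE0 j' / klScale klE0 n)) / Real.pi * (10 + 50 * (4 + 8 / 3 * R.Gfr 1 * U ^ 2) * β / L) * (338 * (4 + 8 / 3 * R.Gfr 1 * U ^ 2) ^ 2) else if 1 ≤ n ∧ j' = n + 1 then 256 / 3 * (27 / (8 * Real.pi ^ 2)) * A2s * (16 * (klScale klE0 j' / klScale klE0 n)) / Real.pi * (10 + 50 * (4 + 8 / 3 * R.Gfr 1 * U ^ 2) * β / L) * (32 * 16 ^ 2 * (4 + 8 / 3 * R.Gfr 1 * U ^ 2) ^ 2) else 0) + (if 1 ≤ n ∧ j' = n + 1 ∧ n + 3 ≤ nScales β then (P.Klam * U) ^ 2 * tX else 0) + (η4 * M4 + M4 * η4) * (if n = 0 then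 (0 : ℝ) else 256 / 3 * (27 / (8 * Real.pi ^ 2)) * A2s * (16 / Real.pi) * (10 + 50 * (4 + 8 / 3 * R.Gfr 1 * U ^ 2) * β / L) * (16384 * (4 + 8 / 3 * R.Gfr 1 * U ^ 2) ^ 2))) ≤
      2⁻¹ * (θ * (3 / 5 * (klIdxPrefactor r (n + 1) * ((P.Klam * U) ^ 2 * klIdxMass n j')))) := by
  obtain ⟨hG4, hG, hB⟩ := klbd_regime_numbers hGfr hGU hGL
  set G : ℝ := 4 + 8 / 3 * R.Gfr 1 * U ^ 2 with hGdef
  set B : ℝ := 10 + 50 * G * β / L with hBdef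
  set ms : ℝ := klIdxMass n j' with hms
  have hms0 : 0 ≤ ms := klIdxMass_nonneg n j'
  have hκ := klbd_angular_numeral_le_two
  have hπ0 : (0 : ℝ) < Real.pi := Real.pi_pos
  have hκ0 : 0 ≤ 27 / (8 * Real.pi ^ 2) * (16 / Real.pi) := by positivity
  have hG0 : 0 ≤ G := by linarith
  have hB0 : 0 ≤ B := by
    have hL0 : (0 : ℝ) ≤ L := Nat.cast_nonneg L
    have : 0 ≤ 50 * G * β / L := by positivity
    rw [hBdef]; linarith
  have hG2 : G ^ 2 ≤ (20 / 3) ^ 2 := pow_le_pow_left₀ hG0 hG 2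
  have hratio : klScale klE0 j' / klScale klE0 n = ms / 15367 := klbd_klScale_div_eq_klIdxMass (by omega)
  have hκD : klScale klE0 (n + 1) * klIdxMass (n + 1) j' = ms * ((4 : ℝ) ^ n)⁻¹ / 32 := klbd_kappaD_sq_eq (le_of_eq hj.symm)
  have h4n : 0 ≤ ((4 : ℝ) ^ n)⁻¹ := by positivity
  rw [hκD] at hη4e
  have hT1 : M4 * M4 * (if 1 ≤ n ∧ n + 2 ≤ j' ∧ n + 3 ≤ nScales β then 256 / 3 * (27 / (8 * Real.pi ^ 2)) * A2s * (16 * (klScale klE0 j' / klScale klE0 n)) / Real.pi * B * (338 * G ^ 2) else if 1 ≤ n ∧ j' = n + 1 then 256 / 3 * (27 / (8 * Real.pi ^ 2)) * A2s * (16 * (klScale klE0 j' / klScale klE0 n)) / Real.pi * B * (32 * 16 ^ 2 * G ^ 2) else 0) ≤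
      (c₄ * U) * (c₄ * U) * (256 / 3 * 2 * A2s * (ms / 15367) * (65 / 4) * (8192 * (20 / 3) ^ 2)) := by
    rw [if_neg (by omega), if_pos ⟨hn, hj⟩, hratio]
    have hre : 256 / 3 * (27 / (8 * Real.pi ^ 2)) * A2s * (16 * (ms / 15367)) / Real.pi * B * (32 * 16 ^ 2 * G ^ 2) =
        256 / 3 * (27 / (8 * Real.pi ^ 2) * (16 / Real.pi)) * A2s * (ms / 15367) * B * (8192 * G ^ 2) := by
      field_simp
      ring
    rw [hre]
    have hMM : M4 * M4 ≤ (c₄ * U) * (c₄ * U) := mul_le_mul hM4c hM4c hM4 (by positivity)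
    gcongr
  have hT2 : (η4 * M4 + M4 * η4) * (if n = 0 then (0 : ℝ) else 256 / 3 * (27 / (8 * Real.pi ^ 2)) * A2s * (16 / Real.pi) * B * (16384 * G ^ 2)) ≤
      (2 * ((e₄ * U * (ms * ((4 : ℝ) ^ n)⁻¹ / 32)) * (c₄ * U))) * (256 / 3 * 2 * A2s * (65 / 4) * (16384 * (20 / 3) ^ 2)) := by
    rw [if_neg (by omega)]
    have hre : 256 / 3 * (27 / (8 * Real.pi ^ 2)) * A2s * (16 / Real.pi) * B * (16384 * G ^ 2) =
        256 / 3 * (27 / (8 * Real.pi ^ 2) * (16 / Real.pi)) * A2s * B * (16384 * G ^ 2) := by ring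
    rw [hre]
    have hηM : η4 * M4 + M4 * η4 ≤ 2 * ((e₄ * U * (ms * ((4 : ℝ) ^ n)⁻¹ / 32)) * (c₄ * U)) := by
      have := mul_le_mul hη4e hM4c hM4 (by positivity)
      linarith [mul_comm η4 M4]
    have h0 : 0 ≤ η4 * M4 + M4 * η4 := by positivity
    gcongr
  have hP : 3 / 2 * r ≤ klIdxPrefactor r (n + 1) := klbd_three_halves_le_klIdxPrefactor_succ hr n
  have hslot : 9 / 20 * (θ * (r * P.Klam ^ 2)) * (U ^ 2 * ms) ≤ 2⁻¹ * (θ * (3 / 5 * (klIdxPrefactor r (n + 1) * ((P.Klam * U) ^ 2 * ms)))) := by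
    have h1 : 0 ≤ θ * (P.Klam ^ 2 * (U ^ 2 * ms)) := by positivity
    have h2 := mul_le_mul_of_nonneg_left hP h1
    linarith
  have hT3 : (if 1 ≤ n ∧ j' = n + 1 ∧ n + 3 ≤ nScales β then (P.Klam * U) ^ 2 * tX else 0) ≤ (P.Klam * U) ^ 2 * tX := by
    split_ifs
    · exact le_rfl
    · positivity
  have hms4 : ms = 15367 / 4 := by
    rw [hms, hj]; unfold klIdxMass; rw [Nat.add_sub_cancel_left]; norm_num
  have hc : (P.Klam * U) ^ 2 * tX = 4 / 15367 * (tX * P.Klam ^ 2) * (U ^ 2 * ms) := by rw [hms4]; ring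
  have hXa : 0 ≤ A2s * c₄ ^ 2 * (U ^ 2 * ms) := by positivity
  have hXb : 0 ≤ A2s * (((4 : ℝ) ^ n)⁻¹ * (e₄ * c₄)) * (U ^ 2 * ms) := by positivity
  have ha : (c₄ * U) * (c₄ * U) * (256 / 3 * 2 * A2s * (ms / 15367) * (65 / 4) * (8192 * (20 / 3) ^ 2)) ≤ A2s * (65709 * c₄ ^ 2) * (U ^ 2 * ms) := by
    linarith
  have hb : (2 * ((e₄ * U * (ms * ((4 : ℝ) ^ n)⁻¹ / 32)) * (c₄ * U))) * (256 / 3 * 2 * A2s * (65 / 4) * (16384 * (20 / 3) ^ 2)) ≤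
      A2s * (2 ^ 27 * ((4 : ℝ) ^ n)⁻¹ * (e₄ * c₄)) * (U ^ 2 * ms) := by
    linarith
  have hfin := mul_le_mul_of_nonneg_right hth (show 0 ≤ U ^ 2 * ms by positivity)
  linarith [hT1, hT2, hT3, hc, ha, hb, hfin, hslot]

/-! ## §2 The same on the SHARP tail rows (α-in-v2): thresholds (T2p♯) 3081 / (T3p♯) 6161 -/

set_option maxHeartbeats 800000 in
/-- **(B2″♯) at the pinned pair from sizes, SHARP tail** — `klpp_scalarRow_direct_pinned_of_sizes` with the edge atom `3·8²·G²` (k3c2-p2 g23 p688107) and threshold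
(T2p♯) `A2s·(3081·c₄² + 2²⁸·4⁻ⁿ·e₄c₄) + (4/15367)·tD·Klam² ≤ (9/20)·θ·r·Klam²` (`3081 = ⌈1155.03·192/72⌉`); α-in-v2, pen (R317)(E1)(α). -/
theorem klpp_scalarRow_direct_pinned_sharp_of_sizes (P : SplitConsts) (R : RenConsts) (hGfr : 0 ≤ R.Gfr 1) {A2s M4 η4 U β θ r c₄ e₄ tD : ℝ} {L : ℕ} [NeZero L] {n j' : ℕ}
    (hn : 1 ≤ n) (hj : j' = n + 1) (hA2s : 0 ≤ A2s) (hU : 0 ≤ U) (hβ : 0 ≤ β) (hθ : 0 ≤ θ) (hr : 0 ≤ r) (hc₄ : 0 ≤ c₄) (he₄ : 0 ≤ e₄)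
    (hM4 : 0 ≤ M4) (hM4c : M4 ≤ c₄ * U) (htD : 0 ≤ tD) (hη4 : 0 ≤ η4) (hη4e : η4 ≤ e₄ * U * (klScale klE0 (n + 1) * klIdxMass (n + 1) j'))
    (hGU : R.Gfr 1 * U ^ 2 ≤ 1) (hGL : 8 * (4 + 8 / 3 * R.Gfr 1 * U ^ 2) * β ≤ L)
    (hth : A2s * (3081 * c₄ ^ 2 + 2 ^ 28 * ((4 : ℝ) ^ n)⁻¹ * (e₄ * c₄)) + 4 / 15367 * (tD * P.Klam ^ 2) ≤ 9 / 20 * (θ * (r * P.Klam ^ 2))) :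
    (M4 * M4 * (if 1 ≤ n ∧ n + 2 ≤ j' then 512 / 3 * (27 / (8 * Real.pi ^ 2)) * A2s * (16 * (klScale klE0 j' / klScale klE0 n)) / Real.pi * (10 + 50 * (4 + 8 / 3 * R.Gfr 1 * U ^ 2) * β / L) * (72 * (4 + 8 / 3 * R.Gfr 1 * U ^ 2) ^ 2) else if 1 ≤ n ∧ j' = n + 1 then 512 / 3 * (27 / (8 * Real.pi ^ 2)) * A2s * (16 * (klScale klE0 j' / klScale klE0 n)) / Real.pi * (10 + 50 * (4 + 8 / 3 * R.Gfr 1 * U ^ 2) * β / L) * (3 * 8 ^ 2 * (4 + 8 / 3 * R.Gfr 1 * U ^ 2) ^ 2) else 0) + (if 1 ≤ n ∧ j' = n + 1 then (P.Klam * U) ^ 2 * tD else 0) + (η4 * M4 + M4 * η4) * (if n = 0 then (0 : ℝ) else 512 / 3 * (27 / (8 * Real.pi ^ 2)) * A2s * (16 / Real.pi) * (10 + 50 * (4 + 8 / 3 * R.Gfr 1 * U ^ 2) * β / L) * (16384 * (4 + 8 / 3 * R.Gfr 1 * U ^ 2) ^ 2))) ≤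
      2⁻¹ * (θ * (3 / 5 * (klIdxPrefactor r (n + 1) * ((P.Klam * U) ^ 2 * klIdxMass n j')))) := by
  obtain ⟨hG4, hG, hB⟩ := klbd_regime_numbers hGfr hGU hGL
  set G : ℝ := 4 + 8 / 3 * R.Gfr 1 * U ^ 2 with hGdef
  set B : ℝ := 10 + 50 * G * β / L with hBdef
  set ms : ℝ := klIdxMass n j' with hms
  have hms0 : 0 ≤ ms := klIdxMass_nonneg n j'
  have hκ := klbd_angular_numeral_le_two
  have hπ0 : (0 : ℝ) < Real.pi := Real.pi_pos
  have hκ0 : 0 ≤ 27 / (8 * Real.pi ^ 2) * (16 / Real.pi) := by positivity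
  have hG0 : 0 ≤ G := by linarith
  have hB0 : 0 ≤ B := by
    have hL0 : (0 : ℝ) ≤ L := Nat.cast_nonneg L
    have : 0 ≤ 50 * G * β / L := by positivity
    rw [hBdef]; linarith
  have hG2 : G ^ 2 ≤ (20 / 3) ^ 2 := pow_le_pow_left₀ hG0 hG 2
  have hratio : klScale klE0 j' / klScale klE0 n = ms / 15367 := klbd_klScale_div_eq_klIdxMass (by omega)
  have hκD : klScale klE0 (n + 1) * klIdxMass (n + 1) j' = ms * ((4 : ℝ) ^ n)⁻¹ / 32 := klbd_kappaD_sq_eq (le_of_eq hj.symm)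
  have h4n : 0 ≤ ((4 : ℝ) ^ n)⁻¹ := by positivity
  rw [hκD] at hη4e
  -- the `M4²` term (D-line `min`-slot coefficient; present only in the interior)
  have hT1 : M4 * M4 * (if 1 ≤ n ∧ n + 2 ≤ j' then 512 / 3 * (27 / (8 * Real.pi ^ 2)) * A2s * (16 * (klScale klE0 j' / klScale klE0 n)) / Real.pi * B * (72 * G ^ 2) else if 1 ≤ n ∧ j' = n + 1 then 512 / 3 * (27 / (8 * Real.pi ^ 2)) * A2s * (16 * (klScale klE0 j' / klScale klE0 n)) / Real.pi * B * (3 * 8 ^ 2 * G ^ 2) else 0) ≤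
      (c₄ * U) * (c₄ * U) * (512 / 3 * 2 * A2s * (ms / 15367) * (65 / 4) * (192 * (20 / 3) ^ 2)) := by
    rw [if_neg (by omega), if_pos ⟨hn, hj⟩, hratio]
    have hre : 512 / 3 * (27 / (8 * Real.pi ^ 2)) * A2s * (16 * (ms / 15367)) / Real.pi * B * (3 * 8 ^ 2 * G ^ 2) =
        512 / 3 * (27 / (8 * Real.pi ^ 2) * (16 / Real.pi)) * A2s * (ms / 15367) * B * (192 * G ^ 2) := by
      field_simp
      ring
    rw [hre]
    have hMM : M4 * M4 ≤ (c₄ * U) * (c₄ * U) := mul_le_mul hM4c hM4c hM4 (by positivity)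
    gcongr
  have hT2 : (η4 * M4 + M4 * η4) * (if n = 0 then (0 : ℝ) else 512 / 3 * (27 / (8 * Real.pi ^ 2)) * A2s * (16 / Real.pi) * B * (16384 * G ^ 2)) ≤
      (2 * ((e₄ * U * (ms * ((4 : ℝ) ^ n)⁻¹ / 32)) * (c₄ * U))) * (512 / 3 * 2 * A2s * (65 / 4) * (16384 * (20 / 3) ^ 2)) := by
    rw [if_neg (by omega)]
    have hre : 512 / 3 * (27 / (8 * Real.pi ^ 2)) * A2s * (16 / Real.pi) * B * (16384 * G ^ 2) =
        512 / 3 * (27 / (8 * Real.pi ^ 2) * (16 / Real.pi)) * A2s * B * (16384 * G ^ 2) := by ring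
    rw [hre]
    have hηM : η4 * M4 + M4 * η4 ≤ 2 * ((e₄ * U * (ms * ((4 : ℝ) ^ n)⁻¹ / 32)) * (c₄ * U)) := by
      have := mul_le_mul hη4e hM4c hM4 (by positivity)
      linarith [mul_comm η4 M4]
    have h0 : 0 ≤ η4 * M4 + M4 * η4 := by positivity
    gcongr
  -- the slot from below: `Pref ≥ 3r/2`
  have hP : 3 / 2 * r ≤ klIdxPrefactor r (n + 1) := klbd_three_halves_le_klIdxPrefactor_succ hr n
  have hslot : 9 / 20 * (θ * (r * P.Klam ^ 2)) * (U ^ 2 * ms) ≤ 2⁻¹ * (θ * (3 / 5 * (klIdxPrefactor r (n + 1) * ((P.Klam * U) ^ 2 * ms)))) := by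
    have h1 : 0 ≤ θ * (P.Klam ^ 2 * (U ^ 2 * ms)) := by positivity
    have h2 := mul_le_mul_of_nonneg_left hP h1
    linarith
  -- assembly (each bound is a numeral times ONE monomial)
  have hT3 : (if 1 ≤ n ∧ j' = n + 1 then (P.Klam * U) ^ 2 * tD else 0) ≤ (P.Klam * U) ^ 2 * tD := by
    split_ifs
    · exact le_rfl
    · positivity
  have hms4 : ms = 15367 / 4 := by
    rw [hms, hj]; unfold klIdxMass; rw [Nat.add_sub_cancel_left]; norm_num
  have hc : (P.Klam * U) ^ 2 * tD = 4 / 15367 * (tD * P.Klam ^ 2) * (U ^ 2 * ms) := by rw [hms4]; ring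
  have hXa : 0 ≤ A2s * c₄ ^ 2 * (U ^ 2 * ms) := by positivity
  have hXb : 0 ≤ A2s * (((4 : ℝ) ^ n)⁻¹ * (e₄ * c₄)) * (U ^ 2 * ms) := by positivity
  have ha : (c₄ * U) * (c₄ * U) * (512 / 3 * 2 * A2s * (ms / 15367) * (65 / 4) * (192 * (20 / 3) ^ 2)) ≤ A2s * (3081 * c₄ ^ 2) * (U ^ 2 * ms) := by
    linarith
  have hb : (2 * ((e₄ * U * (ms * ((4 : ℝ) ^ n)⁻¹ / 32)) * (c₄ * U))) * (512 / 3 * 2 * A2s * (65 / 4) * (16384 * (20 / 3) ^ 2)) ≤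
      A2s * (2 ^ 28 * ((4 : ℝ) ^ n)⁻¹ * (e₄ * c₄)) * (U ^ 2 * ms) := by
    linarith
  have hfin := mul_le_mul_of_nonneg_right hth (show 0 ≤ U ^ 2 * ms by positivity)
  linarith [hT1, hT2, hT3, hc, ha, hb, hfin, hslot]


set_option maxHeartbeats 800000 in
/-- **(B3″♯) at the pinned pair from sizes, SHARP tail** — `klpp_scalarRow_crossed_pinned_of_sizes` with the edge atom `3·16²·G²` and threshold
(T3p♯) `A2s·(6161·c₄² + 2²⁷·4⁻ⁿ·e₄c₄) + (4/15367)·tX·Klam² ≤ (9/20)·θ·r·Klam²` (`6161 = ⌈2711.1·768/338⌉`). -/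
theorem klpp_scalarRow_crossed_pinned_sharp_of_sizes (P : SplitConsts) (R : RenConsts) (hGfr : 0 ≤ R.Gfr 1) {A2s M4 η4 U β θ r c₄ e₄ tX : ℝ} {L : ℕ} [NeZero L] {n j' : ℕ}
    (hn : 1 ≤ n) (hj : j' = n + 1) (hA2s : 0 ≤ A2s) (hU : 0 ≤ U) (hβ : 0 ≤ β) (hθ : 0 ≤ θ) (hr : 0 ≤ r) (hc₄ : 0 ≤ c₄) (he₄ : 0 ≤ e₄)
    (hM4 : 0 ≤ M4) (hM4c : M4 ≤ c₄ * U) (htX : 0 ≤ tX) (hη4 : 0 ≤ η4) (hη4e : η4 ≤ e₄ * U * (klScale klE0 (n + 1) * klIdxMass (n + 1) j'))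
    (hGU : R.Gfr 1 * U ^ 2 ≤ 1) (hGL : 8 * (4 + 8 / 3 * R.Gfr 1 * U ^ 2) * β ≤ L)
    (hth : A2s * (6161 * c₄ ^ 2 + 2 ^ 27 * ((4 : ℝ) ^ n)⁻¹ * (e₄ * c₄)) + 4 / 15367 * (tX * P.Klam ^ 2) ≤ 9 / 20 * (θ * (r * P.Klam ^ 2))) :
    (M4 * M4 * (if 1 ≤ n ∧ n + 2 ≤ j' ∧ n + 3 ≤ nScales β then 256 / 3 * (27 / (8 * Real.pi ^ 2)) * A2s * (16 * (klScale klE0 j' / klScale klE0 n)) / Real.pi * (10 + 50 * (4 + 8 / 3 * R.Gfr 1 * U ^ 2) * β / L) * (338 * (4 + 8 / 3 * R.Gfr 1 * U ^ 2) ^ 2) else if 1 ≤ n ∧ j' = n + 1 then 256 / 3 * (27 / (8 * Real.pi ^ 2)) * A2s * (16 * (klScale klE0 j' / klScale klE0 n)) / Real.pi * (10 + 50 * (4 + 8 / 3 * R.Gfr 1 * U ^ 2) * β / L) * (3 * 16 ^ 2 * (4 + 8 / 3 * R.Gfr 1 * U ^ 2) ^ 2) else 0) + (if 1 ≤ n ∧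 j' = n + 1 ∧ n + 3 ≤ nScales β then (P.Klam * U) ^ 2 * tX else 0) + (η4 * M4 + M4 * η4) * (if n = 0 then (0 : ℝ) else 256 / 3 * (27 / (8 * Real.pi ^ 2)) * A2s * (16 / Real.pi) * (10 + 50 * (4 + 8 / 3 * R.Gfr 1 * U ^ 2) * β / L) * (16384 * (4 + 8 / 3 * R.Gfr 1 * U ^ 2) ^ 2))) ≤
      2⁻¹ * (θ * (3 / 5 * (klIdxPrefactor r (n + 1) * ((P.Klam * U) ^ 2 * klIdxMass n j')))) := by
  obtain ⟨hG4, hG, hB⟩ := klbd_regime_numbers hGfr hGU hGL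
  set G : ℝ := 4 + 8 / 3 * R.Gfr 1 * U ^ 2 with hGdef
  set B : ℝ := 10 + 50 * G * β / L with hBdef
  set ms : ℝ := klIdxMass n j' with hms
  have hms0 : 0 ≤ ms := klIdxMass_nonneg n j'
  have hκ := klbd_angular_numeral_le_two
  have hπ0 : (0 : ℝ) < Real.pi := Real.pi_pos
  have hκ0 : 0 ≤ 27 / (8 * Real.pi ^ 2) * (16 / Real.pi) := by positivity
  have hG0 : 0 ≤ G := by linarith
  have hB0 : 0 ≤ B := by
    have hL0 : (0 : ℝ) ≤ L := Nat.cast_nonneg L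
    have : 0 ≤ 50 * G * β / L := by positivity
    rw [hBdef]; linarith
  have hG2 : G ^ 2 ≤ (20 / 3) ^ 2 := pow_le_pow_left₀ hG0 hG 2
  have hratio : klScale klE0 j' / klScale klE0 n = ms / 15367 := klbd_klScale_div_eq_klIdxMass (by omega)
  have hκD : klScale klE0 (n + 1) * klIdxMass (n + 1) j' = ms * ((4 : ℝ) ^ n)⁻¹ / 32 := klbd_kappaD_sq_eq (le_of_eq hj.symm)
  have h4n : 0 ≤ ((4 : ℝ) ^ n)⁻¹ := by positivity
  rw [hκD] at hη4e
  have hT1 : M4 * M4 * (if 1 ≤ n ∧ n + 2 ≤ j' ∧ n + 3 ≤ nScales β then 256 / 3 * (27 / (8 * Real.pi ^ 2)) * A2s * (16 * (klScale klE0 j' / klScale klE0 n)) / Real.pi * B * (338 * G ^ 2) else if 1 ≤ n ∧ j' = n + 1 then 256 / 3 * (27 / (8 * Real.pi ^ 2)) * A2s * (16 * (klScale klE0 j' / klScale klE0 n)) / Real.pi * B * (3 * 16 ^ 2 * G ^ 2) else 0) ≤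
      (c₄ * U) * (c₄ * U) * (256 / 3 * 2 * A2s * (ms / 15367) * (65 / 4) * (768 * (20 / 3) ^ 2)) := by
    rw [if_neg (by omega), if_pos ⟨hn, hj⟩, hratio]
    have hre : 256 / 3 * (27 / (8 * Real.pi ^ 2)) * A2s * (16 * (ms / 15367)) / Real.pi * B * (3 * 16 ^ 2 * G ^ 2) =
        256 / 3 * (27 / (8 * Real.pi ^ 2) * (16 / Real.pi)) * A2s * (ms / 15367) * B * (768 * G ^ 2) := by
      field_simp
      ring
    rw [hre]
    have hMM : M4 * M4 ≤ (c₄ * U) * (c₄ * U) := mul_le_mul hM4c hM4c hM4 (by positivity)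
    gcongr
  have hT2 : (η4 * M4 + M4 * η4) * (if n = 0 then (0 : ℝ) else 256 / 3 * (27 / (8 * Real.pi ^ 2)) * A2s * (16 / Real.pi) * B * (16384 * G ^ 2)) ≤
      (2 * ((e₄ * U * (ms * ((4 : ℝ) ^ n)⁻¹ / 32)) * (c₄ * U))) * (256 / 3 * 2 * A2s * (65 / 4) * (16384 * (20 / 3) ^ 2)) := by
    rw [if_neg (by omega)]
    have hre : 256 / 3 * (27 / (8 * Real.pi ^ 2)) * A2s * (16 / Real.pi) * B * (16384 * G ^ 2) =
        256 / 3 * (27 / (8 * Real.pi ^ 2) * (16 / Real.pi)) * A2s * B * (16384 * G ^ 2) := by ring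
    rw [hre]
    have hηM : η4 * M4 + M4 * η4 ≤ 2 * ((e₄ * U * (ms * ((4 : ℝ) ^ n)⁻¹ / 32)) * (c₄ * U)) := by
      have := mul_le_mul hη4e hM4c hM4 (by positivity)
      linarith [mul_comm η4 M4]
    have h0 : 0 ≤ η4 * M4 + M4 * η4 := by positivity
    gcongr
  have hP : 3 / 2 * r ≤ klIdxPrefactor r (n + 1) := klbd_three_halves_le_klIdxPrefactor_succ hr n
  have hslot : 9 / 20 * (θ * (r * P.Klam ^ 2)) * (U ^ 2 * ms) ≤ 2⁻¹ * (θ * (3 / 5 * (klIdxPrefactor r (n + 1) * ((P.Klam * U) ^ 2 * ms)))) := by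
    have h1 : 0 ≤ θ * (P.Klam ^ 2 * (U ^ 2 * ms)) := by positivity
    have h2 := mul_le_mul_of_nonneg_left hP h1
    linarith
  have hT3 : (if 1 ≤ n ∧ j' = n + 1 ∧ n + 3 ≤ nScales β then (P.Klam * U) ^ 2 * tX else 0) ≤ (P.Klam * U) ^ 2 * tX := by
    split_ifs
    · exact le_rfl
    · positivity
  have hms4 : ms = 15367 / 4 := by
    rw [hms, hj]; unfold klIdxMass; rw [Nat.add_sub_cancel_left]; norm_num
  have hc : (P.Klam * U) ^ 2 * tX = 4 / 15367 * (tX * P.Klam ^ 2) * (U ^ 2 * ms) := by rw [hms4]; ring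
  have hXa : 0 ≤ A2s * c₄ ^ 2 * (U ^ 2 * ms) := by positivity
  have hXb : 0 ≤ A2s * (((4 : ℝ) ^ n)⁻¹ * (e₄ * c₄)) * (U ^ 2 * ms) := by positivity
  have ha : (c₄ * U) * (c₄ * U) * (256 / 3 * 2 * A2s * (ms / 15367) * (65 / 4) * (768 * (20 / 3) ^ 2)) ≤ A2s * (6161 * c₄ ^ 2) * (U ^ 2 * ms) := by
    linarith
  have hb : (2 * ((e₄ * U * (ms * ((4 : ℝ) ^ n)⁻¹ / 32)) * (c₄ * U))) * (256 / 3 * 2 * A2s * (65 / 4) * (16384 * (20 / 3) ^ 2)) ≤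
      A2s * (2 ^ 27 * ((4 : ℝ) ^ n)⁻¹ * (e₄ * c₄)) * (U ^ 2 * ms) := by
    linarith
  have hfin := mul_le_mul_of_nonneg_right hth (show 0 ≤ U ^ 2 * ms by positivity)
  linarith [hT1, hT2, hT3, hc, ha, hb, hfin, hslot]

end ScalarRowsPinned

end Summit.HubbardSuperconductivity.HubbardSuperconductivity.Theorems.KLRegimeSplit

end
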